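import Literature.NumberTheory.EllipticCurves.BSDRankZeroDensityProofs
import Literature.NumberTheory.EllipticCurves.ShaPrimaryLevelProfile
import HarnessLib

/-!
# `Ш(E/K)[n] = 0` from a Selmer bound meeting a rank lower bound, and `Ш[p] = 0 ⟹ Ш[p^∞] = 0`, `t_p = 0`

PROOF-ONLY file (theorems only), topic `NumberTheory/EllipticCurves`. The closing step of a complete `n`-descent
(Silverman, *AEC*, Thm. X.4.2 and Rem. X.4.1): the exact descent count
`#Sel⁽ⁿ⁾(E/K) = n^{rank E(K)} · #E(K)[n] · #Ш(E/K)[n]` (tree `WeierstrassCurve.natCard_selmerGroup_eq`) turns an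
UPPER bound `#Sel⁽ⁿ⁾ ≤ n^r` together with a LOWER bound `rank ≥ r` into the three equalities
`rank = r`, `E(K)[n] = 0`, `Ш(E/K)[n] = 0`; and `Ш[p] = 0` propagates to the whole `p`-primary part.

* `descentCount_door` — the arithmetic: `N = R·T·S ≤ B ≤ R`, `N ≥ 1` force `S = T = 1`, `R = B`;
* **`sha_inf_torsionBy_eq_bot_of_natCard_selmerGroup_le`** — `#Sel⁽ⁿ⁾ ≤ n^r ≤ n^{rank}` (`n ≥ 2`) gives
  `Ш ∩ H¹(K, E)[n] = 0`, `rank E(K) = r` and `#E(K)[n] = 1`;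
* `sha_eq_zero_of_zsmul_eq_zero`, `sha_torsionBy_eq_bot_of_inf_eq_bot` — `Ш ∩ H¹(K,E)[n] = 0` read inside `Ш`;
* **`primaryComponent_sha_eq_bot_of_inf_eq_bot`** — `Ш[p] = 0 ⟹ Ш[p^∞] = 0` (induction on the exponent);
* **`shaCorank_eq_zero_of_inf_eq_bot`** — `Ш[p] = 0 ⟹ t_p(E) = corank_{ℤ_p} Ш[p^∞] = 0` (`#Ш[p²] = #Ш[p]`, tree
  `shaCorank_eq_zero_of_natCard_sha_torsionBy_sq_eq`).

No conjecture enters; BSD is not touched. [cite: SilvermanAEC2009, Thm. X.4.2, Rem. X.4.1]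
[cite: Greenberg1999LNM, §1 (pp. 54–57)]
-/

noncomputable section

open scoped Classical AddSubgroup

universe u

namespace WeierstrassCurve

open Literature.NumberTheory.EllipticCurves

variable {K : Type u} [Field K] [NumberField K] (W : WeierstrassCurve K)

/-- The arithmetic of the closing step of a descent: natural numbers with `N = R·T·S`, `N ≤ B ≤ R` and `N ≥ 1`
satisfy `S = 1`, `T = 1` and `R = B`. [cite: SilvermanAEC2009, Rem. X.4.1] -/
theorem descentCount_door {N R T S B : ℕ} (h : N = R * T * S) (hle : N ≤ B) (h1 : 1 ≤ N) (hB : B ≤ R) :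
    S = 1 ∧ T = 1 ∧ R = B := by
  subst h
  have hT : 1 ≤ T := Nat.pos_of_ne_zero fun h0 => by simp [h0] at h1
  have hS : 1 ≤ S := Nat.pos_of_ne_zero fun h0 => by simp [h0] at h1
  have hR : 0 < R := by omega
  have hTS : T * S ≤ 1 := by
    have h' : R * (T * S) ≤ R * 1 := by
      rw [mul_one, ← mul_assoc]; exact hle.trans hB
    exact Nat.le_of_mul_le_mul_left h' hR
  have hT' := Nat.mul_le_mul_right S hT
  have hS' := Nat.mul_le_mul_left T hS
  have hT1 : T = 1 := by
    rw [one_mul] at hT'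
    rw [mul_one] at hS'
    omega
  have hS1 : S = 1 := by
    rw [one_mul] at hT'
    omega
  subst hT1; subst hS1
  refine ⟨rfl, rfl, ?_⟩
  rw [mul_one, mul_one] at hle
  omega

/-- **`Ш(E/K) ∩ H¹(K, E)[n] = 0`, `rank E(K) = r` and `E(K)[n] = 0` from `#Sel⁽ⁿ⁾(E/K) ≤ n^r` and `rank ≥ r`**
(`n ≥ 2`): in the exact count `#Sel⁽ⁿ⁾ = n^{rank} · #E(K)[n] · #Ш[n]` (`natCard_selmerGroup_eq`, Silverman X.4.2)
the chain `#Sel⁽ⁿ⁾ ≤ n^r ≤ n^{rank}` forces every factor. [cite: SilvermanAEC2009, Thm. X.4.2, Rem. X.4.1] -/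
theorem sha_inf_torsionBy_eq_bot_of_natCard_selmerGroup_le [W.IsElliptic] {n r : ℕ} (hn : 2 ≤ n)
    (hle : Nat.card (W.selmerGroup n) ≤ n ^ r) (hr : r ≤ W.mordellWeilRank) :
    (W.sha ⊓ AddSubgroup.torsionBy W.galH1 n : AddSubgroup W.galH1) = ⊥ ∧ W.mordellWeilRank = r ∧
      Nat.card (W.toAffine.Point[(n : ℤ)]) = 1 := by
  have hn0 : n ≠ 0 := by omega
  have hcount := W.natCard_selmerGroup_eq hn0
  haveI : Finite (W.selmerGroup n) := W.finite_selmerGroup_holds (Int.natCast_ne_zero.mpr hn0)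
  have hSel : 1 ≤ Nat.card (W.selmerGroup n) := Nat.card_pos
  have hB : n ^ r ≤ n ^ W.mordellWeilRank := Nat.pow_le_pow_right (by omega) hr
  obtain ⟨hS, hT, hR⟩ := descentCount_door hcount hle hSel hB
  exact ⟨AddSubgroup.eq_bot_of_card_eq _ hS, Nat.pow_right_injective hn hR, hT⟩

/-- `Ш ∩ H¹(K, E)[n] = 0` read inside `Ш`: an element of `Ш(E/K)` killed by `n` vanishes.
[cite: SilvermanAEC2009, Thm. X.4.2] -/
theorem sha_eq_zero_of_zsmul_eq_zero {n : ℤ}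
    (hbot : (W.sha ⊓ AddSubgroup.torsionBy W.galH1 n : AddSubgroup W.galH1) = ⊥) (x : W.sha) (hx : n • x = 0) :
    x = 0 := by
  have hmem : (x : W.galH1) ∈ (W.sha ⊓ AddSubgroup.torsionBy W.galH1 n : AddSubgroup W.galH1) := by
    refine AddSubgroup.mem_inf.mpr ⟨x.2, ?_⟩
    change n • (x : W.galH1) = 0
    exact_mod_cast congrArg Subtype.val hx
  rw [hbot, AddSubgroup.mem_bot] at hmem
  exact Subtype.ext hmem

/-- `Ш ∩ H¹(K, E)[n] = 0 ⟹ Ш[m] = 0` (as a subgroup of `Ш`) for every `m` dividing a power of `n` — here for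
`m = n^k`. [cite: SilvermanAEC2009, Thm. X.4.2] -/
theorem sha_torsionBy_pow_eq_bot_of_inf_eq_bot {n : ℤ}
    (hbot : (W.sha ⊓ AddSubgroup.torsionBy W.galH1 n : AddSubgroup W.galH1) = ⊥) (k : ℕ) :
    AddSubgroup.torsionBy W.sha (n ^ k) = ⊥ := by
  have hk : ∀ (k : ℕ) (y : W.sha), (n ^ k) • y = 0 → y = 0 := by
    intro k
    induction k with
    | zero => intro y hy; simpa using hy
    | succ k ih =>
      intro y hy
      rw [pow_succ, mul_zsmul] at hy
      exact W.sha_eq_zero_of_zsmul_eq_zero hbot y (ih _ hy)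
  exact (AddSubgroup.eq_bot_iff_forall _).mpr fun x hx => hk k x (by simpa using hx)

/-- **`Ш[p] = 0 ⟹ Ш(E/K)[p^∞] = 0`**: if `Ш ∩ H¹(K, E)[p] = 0` then the whole `p`-primary part of `Ш(E/K)`
vanishes (induction on the exponent). Light-import form (any `p : ℕ`, no `IsElliptic`) of the tree's
`Literature.NumberTheory.EllipticCurves.primaryComponent_sha_eq_bot_of_inf_torsionBy_eq_bot`
(`BSDSelmerCMPConverseRankOneProofs`, which carries the Iwasawa/CM import closure).
[cite: SilvermanAEC2009, Thm. X.4.2] [cite: Greenberg1999LNM, §1 (pp. 54–57)] -/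
theorem primaryComponent_sha_eq_bot_of_inf_eq_bot (p : ℕ)
    (hbot : (W.sha ⊓ AddSubgroup.torsionBy W.galH1 p : AddSubgroup W.galH1) = ⊥) :
    AddCommGroup.primaryComponent W.sha p = ⊥ := by
  refine (AddSubgroup.eq_bot_iff_forall _).mpr fun x hx => ?_
  obtain ⟨k, hk⟩ := (AddCommGroup.mem_primaryComponent).mp hx
  have hmem : x ∈ AddSubgroup.torsionBy W.sha ((p : ℤ) ^ k) := by
    change ((p : ℤ) ^ k) • x = 0
    rw [← Int.natCast_pow, natCast_zsmul]
    exact hk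
  rw [W.sha_torsionBy_pow_eq_bot_of_inf_eq_bot hbot k] at hmem
  exact (AddSubgroup.mem_bot).mp hmem

/-- **`Ш[p] = 0 ⟹ t_p(E) = corank_{ℤ_p} Ш(E/K)[p^∞] = 0`**: two consecutive descent levels agree
(`#Ш[p²] = #Ш[p] = 1`), so the tree's second-descent door `shaCorank_eq_zero_of_natCard_sha_torsionBy_sq_eq`
closes. [cite: Greenberg1999LNM, §1 (pp. 54–57)] [cite: SilvermanAEC2009, Thm. X.4.2] -/
theorem shaCorank_eq_zero_of_inf_eq_bot [W.IsElliptic] (p : ℕ) [Fact p.Prime]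
    (hbot : (W.sha ⊓ AddSubgroup.torsionBy W.galH1 p : AddSubgroup W.galH1) = ⊥) : W.shaCorank p = 0 := by
  refine shaCorank_eq_zero_of_natCard_sha_torsionBy_sq_eq W p ?_
  have h1 := W.sha_torsionBy_pow_eq_bot_of_inf_eq_bot hbot 1
  have h2 := W.sha_torsionBy_pow_eq_bot_of_inf_eq_bot hbot 2
  rw [pow_one] at h1
  rw [Int.natCast_pow, h2, h1]

/-- **The complete-descent door, assembled**: `#Sel⁽ᵖ⁾(E/K) ≤ p^r` and `rank E(K) ≥ r` (`p` prime) give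
`t_p(E) = 0`, `Ш(E/K)[p^∞] = 0` and `rank E(K) = r` — unconditionally, with no `L`-function input.
[cite: SilvermanAEC2009, Thm. X.4.2, Rem. X.4.1] [cite: Greenberg1999LNM, §1 (pp. 54–57)] -/
theorem shaCorank_eq_zero_of_natCard_selmerGroup_le [W.IsElliptic] (p : ℕ) [hp : Fact p.Prime] {r : ℕ}
    (hle : Nat.card (W.selmerGroup p) ≤ p ^ r) (hr : r ≤ W.mordellWeilRank) :
    W.shaCorank p = 0 ∧ AddCommGroup.primaryComponent W.sha p = ⊥ ∧ W.mordellWeilRank = r := by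
  obtain ⟨hbot, hrank, -⟩ := W.sha_inf_torsionBy_eq_bot_of_natCard_selmerGroup_le hp.out.two_le hle hr
  exact ⟨W.shaCorank_eq_zero_of_inf_eq_bot p hbot, W.primaryComponent_sha_eq_bot_of_inf_eq_bot p hbot, hrank⟩

end WeierstrassCurve

end
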